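import Summits.Ventures.CertifiedManyBodySolver.Downfold.BoxesHg1201ETnLadderP10
import HarnessLib

/-!
# HgBa₂CuO₄₊δ «Hg-1201», object E: the `n`-SLICED sub-boxes of `boxHg1201E_M19b` (@0, p = ⅛), `boxHg1201E_M19` (@0, p = 0.16) and `boxHg1201E_M19P10`
# (@10) — generic membership / refinement / monotonicity, THE `n`-SPLIT LEMMAS, and the post-acq-11549 (±0.02) and CIRC-PADDING filling slices

Venture CertifiedManyBodySolver, cell `pub/hubbard-downfold` (MO-S1 ↔ S2 seam; D-0154 (1)(C) COVERAGE, material (ii) Hg-1201), seat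
`hubbard-cov-hg1201-unc-2` (g2, session `prover-hubbard-cov-hg1201-unc-2-g0-0`); namespace `Summit.Ventures.CertifiedManyBodySolver.Downfold`.
LANE (lead RULING R-mc (a), downfold STATUS l.5195): unc-2 = the `(t, n)` coordinates + the `U`- and `n`-SLICED sub-boxes with rung-leaf images. This is
the `n`-direction sequel of `Downfold/BoxesHg1201ETnLadder.lean` §2–§3 (p608068, same seat g1: the `U`-slices and `holdsOn_boxHg1201E_M19b_of_Usplit`);
part 2 = `Downfold/BoxesHg1201EFillingPadding.lean` (the WORDS on these slices: box-2's kinematic cuts, leaf ⇔ padding word, census).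

SOURCE OF EVERY NUMBER (cell file `router/BOXES/HgBa2CuO4.md` `e6e92f5cad3bfba1`, BOX OF RECORD #19; literature numbers [float]):
* `n` rows: §LIT-PREVIEW v1 l.22 «n (p = 0.125) | [0.835, 0.915] | 0.875 | prov = P5(b) p from the printed T_c(δ)/thermopower scale [CIRC: primary
  Yamamoto–Hu–Tajima PRB 63, 024504 (2000) PAYWALLED, acq-11549; Presland parabola restated in Liang–Bonn–Hardy PRB 73, 180505, arXiv:cond-mat/0510674
  p.1 eq. (1)] | infl = FLOOR(n) ±0.04 (CIRC) → ±0.02 ONCE acq-11549 LANDS»; §n v0 l.130 (M19: «[0.80, 0.88] | 0.84 | … top-up ±0.04»), l.131 (M19b: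
  «hull [0.865, 0.885] | FLOOR(n) ±0.04 (CIRC) → top-up ±0.03»); §OF-RECORD v1.6 l.218 (@10: «[0.79, 0.88] | 0.84 | prov = P5 (1 − p) ∪ PBE pocket
  residual ≤ 0.01»). hubbard-cov-hg1201-lit-1 dossier v1.7.3 N01/N02: «CIRC width ±0.04 persists ONLY because the primary is not held (acq-11549);
  Tabis 2017 arXiv:1702.03348 p.3 Table I restates the scale»; `lit wanted` 2026-08-28: acq-11549 OPEN.
* kinematic density cuts OF RECORD (captain hubbard-cov-hg1201-plan-1 RULINGS, hubbard-obs STATUS 07:28:41Z / 09:00:42Z; hubbard-cov-hg1201-box-2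
  `Downfold/BoxesHg1201EKinematicCoverN.lean` p618642 / `…EP10KinematicCoverN.lean` p621284): `n_k = 179/200` @0-UD (bar `5166800/10⁷`), `n_k′ = 43/50`
  @10 (bar `4767609/10⁷`); certificate strips `R′ = [−27/50, −13/25] × [7/2, 44/5] × [179/200, 183/200]` and `[−49/100, −47/100] × [3, 17/2] × [43/50, 22/25]`.

WHAT IS TYPED
* §0 generic `n`-slice membership for the three boxes (`…_sliceN_mem_iff`), refinement, monotonicity; THE `n`-SPLIT LEMMAS at any split point (`HoldsOn`
  words and `StiffnessBoxCeilingBelow` grammar words: two parts ⇒ the box; certified constants merged at their maximum).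
* §1 the post-acq-11549 slices (CONTEXT sub-boxes — NOT a re-issue: the row stays the lead's §OF-RECORD pen and acq-11549 is OPEN):
  `boxHg1201E_M19b_n02 = M19b ∣ n ∈ [171/200, 179/200]` (p608068), NEW `boxHg1201E_M19_n02 = M19 ∣ n ∈ [41/50, 43/50]`,
  NEW `boxHg1201E_M19P10_n02 = M19P10 ∣ n ∈ [81/100, 43/50]` (the `±0.02` image of the printed @10 construction «(1 − p) ∪ pocket residual 0.01» —
  this seat's reading, CONTEXT); the CIRC PADDING slices `boxHg1201E_M19b_nPadTop = M19b ∣ n ∈ [179/200, 183/200]` and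
  `boxHg1201E_M19P10_nPadTop = M19P10 ∣ n ∈ [43/50, 22/25]` (= the filling ranges of the two certificate strips of record);
  THE EXACT COINCIDENCES `sup(post-acq row) = kinematic cut`: `7/8 + 1/50 = 179/200 = n_k`, `21/25 + 1/50 = 43/50 = n_k′` (`hg1201E_postAcq_sup_eq_cut`);
  all refinements into the boxes of record.

Everything here is PROVED (definitions with bodies; no `sorry`, no new axiom). HONEST FRAMING: typing certifies the ARITHMETIC between printed numbers,
nothing about HgBa₂CuO₄₊δ; every slice is a CONDITIONAL-BY-NAME CONTEXT domain, never a box of record; no hull / row / word / bar / leaf is moved;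
stiffness statements are one-sided CEILINGS — CONTROL/CALIBRATION wording class (xx1), silent on the presence of superconductivity; not a `T_c` or
phase sentence; no summit statement is proved here.

References: D. J. Scalapino, S. R. White, S.-C. Zhang, PRB 47 (1993) 7995, §II [ScalapinoWhiteZhang1993].
-/

noncomputable section

namespace Summit.Ventures.CertifiedManyBodySolver.Downfold
open Set NonemptyInterval Summit.Ventures.CertifiedManyBodySolver.Observables Literature.MathematicalPhysics.QuantumLattice

/-! ## §0 Generic `n`-slices of the three Hg-1201 object-E boxes: membership, refinement, monotonicity, the `n`-SPLIT lemmas -/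

/-- **Membership in an `n`-slice of M19b, unfolded** (generic slice ends `lo ≤ hi`, inward or not): the new filling interval and M19b's own `U/t`,
`t′/t`, `t`, `t″` rows. [folklore] -/
theorem boxHg1201E_M19b_sliceN_mem_iff {lo hi : ℚ} (hle : lo ≤ hi) (p : OneBandCoord → ℝ) :
    (boxHg1201E_M19b.withEntry .filling (Entry.ofEnds lo hi hle .screening)).Mem p ↔
      ((lo : ℝ) ≤ p .filling ∧ p .filling ≤ (hi : ℝ)) ∧
      ((((7/2) : ℚ) : ℝ) ≤ p .UOverT ∧ p .UOverT ≤ (((44/5) : ℚ) : ℝ)) ∧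
      (((-27/50 : ℚ) : ℝ) ≤ p .tpOverT ∧ p .tpOverT ≤ (((-43/100) : ℚ) : ℝ)) ∧
      ((((1/2) : ℚ) : ℝ) ≤ p .tEV ∧ p .tEV ≤ (((3/5) : ℚ) : ℝ)) ∧
      (((0 : ℚ) : ℝ) ≤ p .tppOverT ∧ p .tppOverT ≤ ((0 : ℚ) : ℝ)) := by
  rw [Box.mem_withEntry_iff]
  constructor
  · rintro ⟨hN, h⟩
    exact ⟨(Entry.mem_ofEnds_iff _ _ _ _ _).1 hN,
      (Entry.mem_ofEnds_iff _ _ _ _ _).1 (h .UOverT (by decide) hg1201E_M19b_U rfl),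
      (Entry.mem_ofEnds_iff _ _ _ _ _).1 (h .tpOverT (by decide) hg1201E_M19b_tp rfl),
      (Entry.mem_ofEnds_iff _ _ _ _ _).1 (h .tEV (by decide) hg1201E_M19b_t rfl),
      (Entry.mem_ofEnds_iff _ _ _ _ _).1 (h .tppOverT (by decide) hg1201E_M19b_tpp rfl)⟩
  · rintro ⟨hN, h1, h2, h3, h4⟩
    refine ⟨(Entry.mem_ofEnds_iff _ _ _ _ _).2 hN, ?_⟩
    intro j hj f hf
    cases j <;> simp only [boxHg1201E_M19b, Option.some.injEq, reduceCtorEq, ne_eq, not_true_eq_false] at hf hj <;> subst hf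
    · exact (Entry.mem_ofEnds_iff _ _ _ _ _).2 h1
    · exact (Entry.mem_ofEnds_iff _ _ _ _ _).2 h2
    · exact (Entry.mem_ofEnds_iff _ _ _ _ _).2 h3
    · exact (Entry.mem_ofEnds_iff _ _ _ _ _).2 h4

/-- **Membership in an `n`-slice of M19 (p = 0.16, @0), unfolded.** [folklore] -/
theorem boxHg1201E_M19_sliceN_mem_iff {lo hi : ℚ} (hle : lo ≤ hi) (p : OneBandCoord → ℝ) :
    (boxHg1201E_M19.withEntry .filling (Entry.ofEnds lo hi hle .screening)).Mem p ↔
      ((lo : ℝ) ≤ p .filling ∧ p .filling ≤ (hi : ℝ)) ∧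
      ((((7/2) : ℚ) : ℝ) ≤ p .UOverT ∧ p .UOverT ≤ (((44/5) : ℚ) : ℝ)) ∧
      (((-27/50 : ℚ) : ℝ) ≤ p .tpOverT ∧ p .tpOverT ≤ (((-43/100) : ℚ) : ℝ)) ∧
      ((((1/2) : ℚ) : ℝ) ≤ p .tEV ∧ p .tEV ≤ (((3/5) : ℚ) : ℝ)) ∧
      (((0 : ℚ) : ℝ) ≤ p .tppOverT ∧ p .tppOverT ≤ ((0 : ℚ) : ℝ)) := by
  rw [Box.mem_withEntry_iff]
  constructor
  · rintro ⟨hN, h⟩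
    exact ⟨(Entry.mem_ofEnds_iff _ _ _ _ _).1 hN,
      (Entry.mem_ofEnds_iff _ _ _ _ _).1 (h .UOverT (by decide) hg1201E_M19_U rfl),
      (Entry.mem_ofEnds_iff _ _ _ _ _).1 (h .tpOverT (by decide) hg1201E_M19_tp rfl),
      (Entry.mem_ofEnds_iff _ _ _ _ _).1 (h .tEV (by decide) hg1201E_M19_t rfl),
      (Entry.mem_ofEnds_iff _ _ _ _ _).1 (h .tppOverT (by decide) hg1201E_M19_tpp rfl)⟩
  · rintro ⟨hN, h1, h2, h3, h4⟩
    refine ⟨(Entry.mem_ofEnds_iff _ _ _ _ _).2 hN, ?_⟩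
    intro j hj f hf
    cases j <;> simp only [boxHg1201E_M19, Option.some.injEq, reduceCtorEq, ne_eq, not_true_eq_false] at hf hj <;> subst hf
    · exact (Entry.mem_ofEnds_iff _ _ _ _ _).2 h1
    · exact (Entry.mem_ofEnds_iff _ _ _ _ _).2 h2
    · exact (Entry.mem_ofEnds_iff _ _ _ _ _).2 h3
    · exact (Entry.mem_ofEnds_iff _ _ _ _ _).2 h4

/-- **Membership in an `n`-slice of the @10 box M19P10, unfolded** (its own rows `U/t [3, 17/2]`, `t′/t [−49/100, −7/20]`, `t [51/100, 17/25]`, `t″ 0`). [folklore] -/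
theorem boxHg1201E_M19P10_sliceN_mem_iff {lo hi : ℚ} (hle : lo ≤ hi) (p : OneBandCoord → ℝ) :
    (boxHg1201E_M19P10.withEntry .filling (Entry.ofEnds lo hi hle .screening)).Mem p ↔
      ((lo : ℝ) ≤ p .filling ∧ p .filling ≤ (hi : ℝ)) ∧
      (((3 : ℚ) : ℝ) ≤ p .UOverT ∧ p .UOverT ≤ (((17/2) : ℚ) : ℝ)) ∧
      ((((-49/100) : ℚ) : ℝ) ≤ p .tpOverT ∧ p .tpOverT ≤ (((-7/20) : ℚ) : ℝ)) ∧
      ((((51/100) : ℚ) : ℝ) ≤ p .tEV ∧ p .tEV ≤ (((17/25) : ℚ) : ℝ)) ∧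
      (((0 : ℚ) : ℝ) ≤ p .tppOverT ∧ p .tppOverT ≤ ((0 : ℚ) : ℝ)) := by
  rw [Box.mem_withEntry_iff]
  constructor
  · rintro ⟨hN, h⟩
    exact ⟨(Entry.mem_ofEnds_iff _ _ _ _ _).1 hN,
      (Entry.mem_ofEnds_iff _ _ _ _ _).1 (h .UOverT (by decide) hg1201E_M19P10_U rfl),
      (Entry.mem_ofEnds_iff _ _ _ _ _).1 (h .tpOverT (by decide) hg1201E_M19P10_tp rfl),
      (Entry.mem_ofEnds_iff _ _ _ _ _).1 (h .tEV (by decide) hg1201E_M19P10_t rfl),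
      (Entry.mem_ofEnds_iff _ _ _ _ _).1 (h .tppOverT (by decide) hg1201E_M19P10_tpp rfl)⟩
  · rintro ⟨hN, h1, h2, h3, h4⟩
    refine ⟨(Entry.mem_ofEnds_iff _ _ _ _ _).2 hN, ?_⟩
    intro j hj f hf
    cases j <;> simp only [boxHg1201E_M19P10, Option.some.injEq, reduceCtorEq, ne_eq, not_true_eq_false] at hf hj <;> subst hf
    · exact (Entry.mem_ofEnds_iff _ _ _ _ _).2 h1
    · exact (Entry.mem_ofEnds_iff _ _ _ _ _).2 h2
    · exact (Entry.mem_ofEnds_iff _ _ _ _ _).2 h3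
    · exact (Entry.mem_ofEnds_iff _ _ _ _ _).2 h4

/-- **`n`-slice monotonicity in the ends (M19b)**: `[lo, hi] ⊆ [lo', hi']` ⇒ the `lo–hi` slice refines the `lo'–hi'` slice. [folklore] -/
theorem boxHg1201E_M19b_sliceN_mono {lo hi lo' hi' : ℚ} (hle : lo ≤ hi) (hle' : lo' ≤ hi') (h₁ : lo' ≤ lo) (h₂ : hi ≤ hi') :
    (boxHg1201E_M19b.withEntry .filling (Entry.ofEnds lo hi hle .screening)).Refines
      (boxHg1201E_M19b.withEntry .filling (Entry.ofEnds lo' hi' hle' .screening)) := by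
  intro p hp
  rw [boxHg1201E_M19b_sliceN_mem_iff] at hp ⊢
  obtain ⟨⟨ha, hb⟩, hrest⟩ := hp
  have h₁' : ((lo' : ℚ) : ℝ) ≤ ((lo : ℚ) : ℝ) := by exact_mod_cast h₁
  have h₂' : ((hi : ℚ) : ℝ) ≤ ((hi' : ℚ) : ℝ) := by exact_mod_cast h₂
  exact ⟨⟨h₁'.trans ha, hb.trans h₂'⟩, hrest⟩

/-- **Every `n`-slice of M19 with ends inside `[4/5, 22/25]` refines M19.** [folklore] -/
theorem boxHg1201E_M19_sliceN_refines {lo hi : ℚ} (hle : lo ≤ hi) (hlo : 4/5 ≤ lo) (hhi : hi ≤ 22/25) :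
    (boxHg1201E_M19.withEntry .filling (Entry.ofEnds lo hi hle .screening)).Refines boxHg1201E_M19 :=
  Box.withEntry_refines (e₀ := hg1201E_M19_n) rfl (fun _ hx => Entry.mem_ofEnds_mono hlo hhi hx)

/-- **Every `n`-slice of M19P10 with ends inside `[4/5, 22/25]` refines the typed @10 box `boxHg1201E_M19P10`, and with ends inside `[79/100, 22/25]` it refines
the @10 box OF RECORD `boxHg1201E_M19P10nR`** (R-mg (e); p609726). [folklore] -/
theorem boxHg1201E_M19P10_sliceN_refines {lo hi : ℚ} (hle : lo ≤ hi) (hhi : hi ≤ 22/25) :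
    (4/5 ≤ lo → (boxHg1201E_M19P10.withEntry .filling (Entry.ofEnds lo hi hle .screening)).Refines boxHg1201E_M19P10) ∧
    (79/100 ≤ lo → (boxHg1201E_M19P10.withEntry .filling (Entry.ofEnds lo hi hle .screening)).Refines boxHg1201E_M19P10nR) := by
  refine ⟨fun hlo => Box.withEntry_refines (e₀ := hg1201E_M19P10_n) rfl (fun _ hx => Entry.mem_ofEnds_mono hlo hhi hx), fun hlo => ?_⟩
  intro p hp
  obtain ⟨⟨ha, hb⟩, h1, h2, h3, h4⟩ := (boxHg1201E_M19P10_sliceN_mem_iff hle p).1 hp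
  have hlo' : (((79/100 : ℚ)) : ℝ) ≤ ((lo : ℚ) : ℝ) := by exact_mod_cast hlo
  have hhi' : ((hi : ℚ) : ℝ) ≤ (((22/25 : ℚ)) : ℝ) := by exact_mod_cast hhi
  exact (boxHg1201E_M19P10nR_mem_iff p).2 ⟨⟨hlo'.trans ha, hb.trans hhi'⟩, h1, h2, h3, h4⟩

/-- **THE `n`-SPLIT LEMMA for M19b (any split point)**: for `167/200 ≤ m ≤ 183/200`, a word on the slice `n ∈ [167/200, m]` and a word on `n ∈ [m, 183/200]`
give the word on `boxHg1201E_M19b` (the `n`-analog of `holdsOn_boxHg1201E_M19b_of_Usplit`, p608068). [folklore] -/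
theorem holdsOn_boxHg1201E_M19b_of_Nsplit {W : (OneBandCoord → ℝ) → Prop} {m : ℚ} (hlo : 167/200 ≤ m) (hhi : m ≤ 183/200)
    (h₁ : HoldsOn W (boxHg1201E_M19b.withEntry .filling (Entry.ofEnds (167/200) m hlo .screening)))
    (h₂ : HoldsOn W (boxHg1201E_M19b.withEntry .filling (Entry.ofEnds m (183/200) hhi .screening))) :
    HoldsOn W boxHg1201E_M19b := by
  intro p hp
  obtain ⟨a0, b0, a1, b1, hN1, hN2, a3, b3, a4, b4⟩ := (boxHg1201E_M19b_mem_iff p).1 hp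
  rcases le_total (p .filling) (m : ℝ) with hm | hm
  · refine h₁ p ((boxHg1201E_M19b_sliceN_mem_iff hlo p).2 ⟨⟨?_, hm⟩, ⟨a0, b0⟩, ⟨a1, b1⟩, ⟨a3, b3⟩, ⟨a4, b4⟩⟩)
    exact_mod_cast hN1
  · refine h₂ p ((boxHg1201E_M19b_sliceN_mem_iff hhi p).2 ⟨⟨hm, ?_⟩, ⟨a0, b0⟩, ⟨a1, b1⟩, ⟨a3, b3⟩, ⟨a4, b4⟩⟩)
    exact_mod_cast hN2

/-- **THE `n`-SPLIT LEMMA for the @10 box M19P10 (any split point `4/5 ≤ m ≤ 22/25`).** [folklore] -/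
theorem holdsOn_boxHg1201E_M19P10_of_Nsplit {W : (OneBandCoord → ℝ) → Prop} {m : ℚ} (hlo : 4/5 ≤ m) (hhi : m ≤ 22/25)
    (h₁ : HoldsOn W (boxHg1201E_M19P10.withEntry .filling (Entry.ofEnds (4/5) m hlo .screening)))
    (h₂ : HoldsOn W (boxHg1201E_M19P10.withEntry .filling (Entry.ofEnds m (22/25) hhi .screening))) :
    HoldsOn W boxHg1201E_M19P10 := by
  intro p hp
  obtain ⟨a0, b0, a1, b1, hN1, hN2, a3, b3, a4, b4⟩ := (boxHg1201E_M19P10_mem_iff p).1 hp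
  rcases le_total (p .filling) (m : ℝ) with hm | hm
  · refine h₁ p ((boxHg1201E_M19P10_sliceN_mem_iff hlo p).2 ⟨⟨?_, hm⟩, ⟨a0, b0⟩, ⟨a1, b1⟩, ⟨a3, b3⟩, ⟨a4, b4⟩⟩)
    exact_mod_cast hN1
  · refine h₂ p ((boxHg1201E_M19P10_sliceN_mem_iff hhi p).2 ⟨⟨hm, ?_⟩, ⟨a0, b0⟩, ⟨a1, b1⟩, ⟨a3, b3⟩, ⟨a4, b4⟩⟩)
    exact_mod_cast hN2

/-- **THE `n`-SPLIT LEMMA for M19 (@0, p = 0.16; any split point `4/5 ≤ m ≤ 22/25`).** [folklore] -/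
theorem holdsOn_boxHg1201E_M19_of_Nsplit {W : (OneBandCoord → ℝ) → Prop} {m : ℚ} (hlo : 4/5 ≤ m) (hhi : m ≤ 22/25)
    (h₁ : HoldsOn W (boxHg1201E_M19.withEntry .filling (Entry.ofEnds (4/5) m hlo .screening)))
    (h₂ : HoldsOn W (boxHg1201E_M19.withEntry .filling (Entry.ofEnds m (22/25) hhi .screening))) :
    HoldsOn W boxHg1201E_M19 := by
  intro p hp
  obtain ⟨a0, b0, a1, b1, hN1, hN2, a3, b3, a4, b4⟩ := (boxHg1201E_M19_mem_iff p).1 hp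
  rcases le_total (p .filling) (m : ℝ) with hm | hm
  · refine h₁ p ((boxHg1201E_M19_sliceN_mem_iff hlo p).2 ⟨⟨?_, hm⟩, ⟨a0, b0⟩, ⟨a1, b1⟩, ⟨a3, b3⟩, ⟨a4, b4⟩⟩)
    exact_mod_cast hN1
  · refine h₂ p ((boxHg1201E_M19_sliceN_mem_iff hhi p).2 ⟨⟨hm, ?_⟩, ⟨a0, b0⟩, ⟨a1, b1⟩, ⟨a3, b3⟩, ⟨a4, b4⟩⟩)
    exact_mod_cast hN2

/-- Stiffness words are monotone in the constant on any box: `c ≤ c'` ⇒ the `c`-word gives the `c'`-word. [cite: ScalapinoWhiteZhang1993, §II] -/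
theorem holdsOn_stiffnessWord_mono {B : OneBandBox} {c c' : ℚ} (hcc : c ≤ c')
    (h : HoldsOn (fun p : OneBandCoord → ℝ => ObsStiffnessSeqCeilingAt (p .tpOverT) (p .UOverT) (p .filling) c) B) :
    HoldsOn (fun p : OneBandCoord → ℝ => ObsStiffnessSeqCeilingAt (p .tpOverT) (p .UOverT) (p .filling) c') B :=
  h.mono fun _ hp => hp.mono hcc

/-- Two grammar words at one bar on the two parts of an `n`-split of M19b give the grammar word on M19b (the two certified constants are merged at their
maximum, which is still `≤ bar`). [cite: ScalapinoWhiteZhang1993, §II] -/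
theorem stiffnessBoxCeilingBelow_boxHg1201E_M19b_of_Nsplit {bar : ℚ} {m : ℚ} (hlo : 167/200 ≤ m) (hhi : m ≤ 183/200)
    (h₁ : StiffnessBoxCeilingBelow (boxHg1201E_M19b.withEntry .filling (Entry.ofEnds (167/200) m hlo .screening)) bar)
    (h₂ : StiffnessBoxCeilingBelow (boxHg1201E_M19b.withEntry .filling (Entry.ofEnds m (183/200) hhi .screening)) bar) :
    StiffnessBoxCeilingBelow boxHg1201E_M19b bar := by
  obtain ⟨c₁, hc₁, hW₁⟩ := h₁
  obtain ⟨c₂, hc₂, hW₂⟩ := h₂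
  exact stiffnessBoxCeilingBelow_of_holdsOn (c := max c₁ c₂) (max_le hc₁ hc₂)
    (holdsOn_boxHg1201E_M19b_of_Nsplit hlo hhi (holdsOn_stiffnessWord_mono (le_max_left _ _) hW₁)
      (holdsOn_stiffnessWord_mono (le_max_right _ _) hW₂))

/-- The @10 twin: two grammar words on the parts of an `n`-split of M19P10 give the grammar word on M19P10. [cite: ScalapinoWhiteZhang1993, §II] -/
theorem stiffnessBoxCeilingBelow_boxHg1201E_M19P10_of_Nsplit {bar : ℚ} {m : ℚ} (hlo : 4/5 ≤ m) (hhi : m ≤ 22/25)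
    (h₁ : StiffnessBoxCeilingBelow (boxHg1201E_M19P10.withEntry .filling (Entry.ofEnds (4/5) m hlo .screening)) bar)
    (h₂ : StiffnessBoxCeilingBelow (boxHg1201E_M19P10.withEntry .filling (Entry.ofEnds m (22/25) hhi .screening)) bar) :
    StiffnessBoxCeilingBelow boxHg1201E_M19P10 bar := by
  obtain ⟨c₁, hc₁, hW₁⟩ := h₁
  obtain ⟨c₂, hc₂, hW₂⟩ := h₂
  exact stiffnessBoxCeilingBelow_of_holdsOn (c := max c₁ c₂) (max_le hc₁ hc₂)
    (holdsOn_boxHg1201E_M19P10_of_Nsplit hlo hhi (holdsOn_stiffnessWord_mono (le_max_left _ _) hW₁)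
      (holdsOn_stiffnessWord_mono (le_max_right _ _) hW₂))

/-! ## §1 The post-acq-11549 filling slices (±0.02) and the CIRC padding slices; the exact coincidences `sup(post-acq row) = n_k` -/

/-- Post-acq-11549 filling slice of column M19 (p = 0.16, @0): `0.84 ± 0.02 = [41/50, 43/50]` (box l.130 «top-up ±0.04 (CIRC …) until acq-11549 lands» read
with l.22's «→ ±0.02»; CONTEXT until the lead re-issues). [folklore] -/
def hg1201E_M19_n02 : Entry := Entry.ofEnds (41/50) (43/50) (by norm_num) .screening

/-- Post-acq-11549 filling slice of column M19 @10 GPa: the `±0.02` image of the PRINTED @10 construction «P5 (1 − p) ∪ PBE pocket residual ≤ 0.01» (box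
l.218: today `[0.80, 0.88] ∪ ([0.80, 0.88] − 0.01) = [0.79, 0.88]`) = `[0.82, 0.86] ∪ [0.81, 0.85] = [81/100, 43/50]` — THIS SEAT'S READING of the two printed
clauses, CONTEXT only; only the upper end `43/50` matters below. [folklore] -/
def hg1201E_nP10_02 : Entry := Entry.ofEnds (81/100) (43/50) (by norm_num) .screening

/-- The CIRC PADDING of the M19b filling row above the post-acq slice: `n ∈ [179/200, 183/200]` (`= 0.875 + [0.02, 0.04]`, hole doping `p ∈ [0.085, 0.105]`). [folklore] -/
def hg1201E_nPadTop : Entry := Entry.ofEnds (179/200) (183/200) (by norm_num) .screening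

/-- The CIRC PADDING of the @10 filling row above its post-acq slice: `n ∈ [43/50, 22/25]` (`= 0.84 + [0.02, 0.04]`, `p ∈ [0.12, 0.14]`). [folklore] -/
def hg1201E_nP10PadTop : Entry := Entry.ofEnds (43/50) (22/25) (by norm_num) .screening

/-- **`boxHg1201E_M19_n02`**: M19 (@0, p = 0.16) with the filling re-issued INWARD to the post-acq slice `[41/50, 43/50]` (CONTEXT sub-box). [folklore] -/
def boxHg1201E_M19_n02 : OneBandBox := boxHg1201E_M19.withEntry .filling hg1201E_M19_n02

/-- **`boxHg1201E_M19P10_n02`**: the @10 box with the filling re-issued to the post-acq slice `[81/100, 43/50]` (CONTEXT sub-box; refines both the typed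
`boxHg1201E_M19P10` and the box of record `boxHg1201E_M19P10nR`). [folklore] -/
def boxHg1201E_M19P10_n02 : OneBandBox := boxHg1201E_M19P10.withEntry .filling hg1201E_nP10_02

/-- **`boxHg1201E_M19b_nPadTop`**: M19b restricted to the CIRC padding `n ∈ [179/200, 183/200]` — the filling range of the certificate strip `R′` of record
(captain hubbard-cov-hg1201-plan-1 PLAN v0.3 Δ1: `R′ = t′ ∈ [−27/50, −13/25] × U ∈ [7/2, 44/5] × n ∈ [179/200, 183/200]`). [folklore] -/
def boxHg1201E_M19b_nPadTop : OneBandBox := boxHg1201E_M19b.withEntry .filling hg1201E_nPadTop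

/-- **`boxHg1201E_M19P10_nPadTop`**: the @10 box restricted to its CIRC padding `n ∈ [43/50, 22/25]` (the filling range of the @10 strip of record
`[−49/100, −47/100] × [3, 17/2] × [43/50, 22/25]`, captain RULING «n_k′ = 43/50», hubbard-obs STATUS 09:00:42Z). [folklore] -/
def boxHg1201E_M19P10_nPadTop : OneBandBox := boxHg1201E_M19P10.withEntry .filling hg1201E_nP10PadTop

/-- **THE EXACT COINCIDENCES `sup(post-acq row) = kinematic cut of record`** (pure arithmetic): @0-UD `7/8 + 1/50 = 179/200 = n_k`; @10 and @0-opt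
`21/25 + 1/50 = 43/50 = n_k′`; the CIRC rows are the `±1/25` versions `7/8 ± 1/25 = [167/200, 183/200]`, `21/25 ± 1/25 = [4/5, 22/25]`; and the padding above
the post-acq slice is exactly `[n_k, n_k + 1/50]` in both columns. [folklore] -/
theorem hg1201E_postAcq_sup_eq_cut :
    ((7/8 : ℚ) + 1/50 = 179/200 ∧ (7/8 : ℚ) - 1/50 = 171/200 ∧ (7/8 : ℚ) + 1/25 = 183/200 ∧ (7/8 : ℚ) - 1/25 = 167/200) ∧
    ((21/25 : ℚ) + 1/50 = 43/50 ∧ (21/25 : ℚ) - 1/50 = 41/50 ∧ (21/25 : ℚ) + 1/25 = 22/25 ∧ (21/25 : ℚ) - 1/25 = 4/5) ∧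
    ((183/200 : ℚ) - 179/200 = 1/50 ∧ (22/25 : ℚ) - 43/50 = 1/50) ∧
    (hg1201E_n02.encl.snd = 179/200 ∧ hg1201E_nPadTop.encl.fst = 179/200 ∧ hg1201E_M19_n02.encl.snd = 43/50 ∧
      hg1201E_nP10_02.encl.snd = 43/50 ∧ hg1201E_nP10PadTop.encl.fst = 43/50) := by
  refine ⟨⟨by norm_num, by norm_num, by norm_num, by norm_num⟩, ⟨by norm_num, by norm_num, by norm_num, by norm_num⟩, ⟨by norm_num, by norm_num⟩,
    ?_, ?_, ?_, ?_, ?_⟩ <;> simp [hg1201E_n02, hg1201E_nPadTop, hg1201E_M19_n02, hg1201E_nP10_02, hg1201E_nP10PadTop]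

/-- **Refinements**: the post-acq and padding slices are INWARD: `…M19b_n02`, `…M19b_nPadTop ⊆ boxHg1201E_M19b`; `…M19_n02 ⊆ boxHg1201E_M19`;
`…M19P10_n02`, `…M19P10_nPadTop ⊆ boxHg1201E_M19P10 ⊆ boxHg1201E_M19P10nR`. Hence every word of record on the boxes holds on them. [folklore] -/
theorem hg1201E_fillingSlices_refine :
    boxHg1201E_M19b_n02.Refines boxHg1201E_M19b ∧ boxHg1201E_M19b_nPadTop.Refines boxHg1201E_M19b ∧
    boxHg1201E_M19_n02.Refines boxHg1201E_M19 ∧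
    (boxHg1201E_M19P10_n02.Refines boxHg1201E_M19P10 ∧ boxHg1201E_M19P10_n02.Refines boxHg1201E_M19P10nR) ∧
    (boxHg1201E_M19P10_nPadTop.Refines boxHg1201E_M19P10 ∧ boxHg1201E_M19P10_nPadTop.Refines boxHg1201E_M19P10nR) :=
  ⟨boxHg1201E_M19b_nSlices_refine.1, boxHg1201E_M19b_sliceN_refines _ (by norm_num) le_rfl,
    boxHg1201E_M19_sliceN_refines _ (by norm_num) (by norm_num),
    ⟨(boxHg1201E_M19P10_sliceN_refines _ (by norm_num)).1 (by norm_num), (boxHg1201E_M19P10_sliceN_refines _ (by norm_num)).2 (by norm_num)⟩,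
    ⟨(boxHg1201E_M19P10_sliceN_refines _ le_rfl).1 (by norm_num), (boxHg1201E_M19P10_sliceN_refines _ le_rfl).2 (by norm_num)⟩⟩

end Summit.Ventures.CertifiedManyBodySolver.Downfold

end
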